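import Summits.QuantumFields.YangMills.Theorems.UV3PinnedRatioOfTowerBounds
import HarnessLib

/-!
# R3 (cell `ym3-torus`, YM₃ on T³ — a ladder RUNG, NOT d = 4, NOT the Clay problem), UV3-node side of the 19936 deep-heights target —
# **THE A.E. BRIDGE: the level-by-level (7)-weighted tower of ✓`UV3PinnedRatioOfTowerBounds` and the tree's restricted tower
# `resDensity F γ K S k = T_{k−1}⋯T_0(𝟙_S·e^{−β_K A})` (lit `T3RestrictedUnitDensity`) of the history event `S = {U | ∀ i ≤ j, Ū^i U ∈ C i}`
# are EQUAL `dV_k`-ALMOST EVERYWHERE at every level `k ≥ j`; and the (Z-DOOR) in `resDensity` letters for an arbitrary measurable event**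

Seat `ym3-torus-px13` g11.  THEOREMS ONLY (0 `def`, 0 `sorry`); `--supports stmt-QuantumFields-19936 --as helper`; count-neutral.  ★★OWNER RULING №32 (1):
Z-level letters are integrals, `∀ᵐ` inequalities or `essSup` anchors — never point values of a Radon–Nikodym version.  The ideator's (α′) skeleton
(`Cruxes/HistoryTailL/Lines/pinned_stability.lean`) writes its stubs over `resDensity` (restriction at level `0`, free transport); a proof of the
pinned (41) naturally lands on the level-by-level tower `σ` (indicator of `C (i+1)` inserted after each `T_i`, as (41)'s induction restricts histories).
This file certifies that the two currencies are interchangeable: same integrals against every bounded measurable test function (push-forward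
identity (2)∕(6)), hence a.e.-equal densities — so an `∀ᵐ` bound on one is an `∀ᵐ` bound on the other.

WHAT IS PROVED (ns `…Theorems.UV3PinnedTowerAeBridge`; `F : T3Family`, `0 ≤ γ`, run `K`, weights `C i` measurable, pinned tower `σ` hypothesis-described
as in ✓`UV3PinnedRatioOfTowerBounds`: `hσ0`, `hσw` (levels `≤ j`), `hσf` (levels `> j`)).
* §1 ★★ `integral_pinnedTower_mul_above` — the weighted push-forward ABOVE the pinned height: for `j ≤ k ≤ m + K` and bounded measurable `f`,
  `∫ σ_k·f dV_k = ∫ ρ₀(U)·𝟙{∀ i ≤ j, Ū^i U ∈ C i}·f(Ū^k U) dU` (✓`integral_pinnedTower_mul` at `i = j`, then lit `RTOpI.isRT` with `f ∘ avg_k`).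
* §2 ★★★ `pinnedTower_ae_eq_resDensity` — `σ_k =ᵐ[dV_k] resDensity F γ K {U | ∀ i ≤ j, Ū^i U ∈ C i} k` for `j ≤ k ≤ m + K`
  (equal set integrals on every measurable set — §1 vs lit ✓`integral_resDensity_mul` with `f = 𝟙_s` — and `Integrable.ae_eq_of_forall_setIntegral_eq`).
* §3 ★★ `gibbsK_real_le_of_resDensityBounds` — THE (Z-DOOR) IN `resDensity` LETTERS, ANY measurable event `S` of finest-lattice fields, any level
  `k ≤ K`: (Z-UP) `∀ᵐ V ∂dV_k, resDensity F γ K S k V ≤ exp(−E + Cu)·w` ∧ (Z-LOW) `exp(−E − Cl) ≤ ∫ ρ_k dV_k` ⟹ `Gibbs_K(S) ≤ exp(Cu + Cl)·w`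
  (`Gibbs_K(S) = (∫ resDensity S k dV_k)∕Z_K` by lit `integral_resDensity_mul` with `f ≡ 1` + lit `integral_gibbsMeasure`; then as in ✓`UV3PinnedRatioOfTowerBounds`).
  The `hP`-shaped consumer with the `essSup` anchor is LEAD ★w1-19936 g11's (A1″) door in the skeleton; this is the generic per-event letter.

HONEST SCOPE.  Measure-theoretic bookkeeping; no bound of [Balaban1985UV3] is proved; S-step∕S-low∕`hP`∕`stub_pinnedRatio`∕`HistoryTailL` (19936)∕K1∕(Q)∕UV3's inputs
NOT proved; nothing continuum ∕ OS ∕ mass-gap ∕ Clay.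
References: T. Bałaban, CMP **102** (1985) 255–275 [Balaban1985UV3] ((1)–(2) p. 256, (6)–(8) pp. 257–258, (41) p. 266); T. Bałaban, CMP **98** (1985) 17–51
[Balaban1985Averaging] ((10) p. 19).
-/

set_option autoImplicit false

noncomputable section

namespace Summit.QuantumFields.YangMills.Theorems.UV3PinnedTowerAeBridge

open MeasureTheory
open Literature.MathematicalPhysics.QuantumFieldTheory.Balaban1983to89
open Literature.MathematicalPhysics.QuantumFieldTheory.Balaban1983to89.T3ContinuumYM3Torus
open Literature.MathematicalPhysics.QuantumFieldTheory.Balaban1983to89.Missing (boltzmann partitionFn isProbabilityMeasure_fieldMeasure partitionFn_pos')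
open Literature.MathematicalPhysics.QuantumFieldTheory.Balaban1983to89.T3UnitLawDensityEML (ℰp measurableE_ℰp emlDensity rt
  measurable_blockAvg haarAC_blockAvg emlDensity_zero integrable_emlDensity integral_emlDensity_mul)
open Literature.MathematicalPhysics.QuantumFieldTheory.Balaban1983to89.T3UnitScaleTilt (gibbsK gibbsK_eq)
open Literature.MathematicalPhysics.QuantumFieldTheory.Balaban1983to89.T3RestrictedUnitDensity (resDensity integrable_resDensity
  integral_resDensity_mul)
open Summit.QuantumFields.YangMills.Theorems.UV3PinnedRatioOfTowerBounds (integrable_pinnedTower integral_pinnedTower_mul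
  measurableSet_histEvent integral_emlDensity_eq_partitionFn)

variable (F : T3Family) {γ : ℝ} (K : ℕ)

/-! ## §1 The weighted push-forward above the pinned height -/

/-- ★★ **THE WEIGHTED PUSH-FORWARD IDENTITY ABOVE THE PINNED HEIGHT**: for `j ≤ k ≤ m + K` and bounded measurable `f` on level-`k` fields,
`∫ σ_k(V)·f(V) dV_k = ∫ ρ₀(U)·𝟙{∀ i ≤ j, Ū^i U ∈ C i}·f(Ū^k U) dU` — ✓`integral_pinnedTower_mul` at the pinned height, then (2)∕(6) with the test function
`f ∘ avg_k` for the free transports. [cite: Balaban1985UV3, (2) p.256, (6)–(8) pp.257–258; Balaban1985Averaging, (10) p.19] -/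
theorem integral_pinnedTower_mul_above (hγ : 0 ≤ γ) (C : (i : ℕ) → Set (GaugeField (F.P K) i (Matrix.specialUnitaryGroup (Fin 2) ℂ)))
    (hC : ∀ i, MeasurableSet (C i)) (j : ℕ) (σ : (k : ℕ) → Density (F.P K) k (Matrix.specialUnitaryGroup (Fin 2) ℂ))
    (hσ0 : σ 0 = (C 0).indicator (emlDensity F γ K 0))
    (hσw : ∀ (i : ℕ) (h : i + 1 ≤ F.m + K), i + 1 ≤ j → σ (i + 1) = (C (i + 1)).indicator ((rt F K i h).T (σ i)))
    (hσf : ∀ (i : ℕ) (h : i + 1 ≤ F.m + K), j ≤ i → σ (i + 1) = (rt F K i h).T (σ i)) :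
    ∀ k : ℕ, j ≤ k → k ≤ F.m + K →
      ∀ f : GaugeField (F.P K) k (Matrix.specialUnitaryGroup (Fin 2) ℂ) → ℝ, Measurable f → (∃ B : ℝ, ∀ V, |f V| ≤ B) →
        ∫ V, σ k V * f V ∂fieldMeasure (F.P K) k (Matrix.specialUnitaryGroup (Fin 2) ℂ) =
          ∫ U, emlDensity F γ K 0 U *
            (Set.indicator {U : GaugeField (F.P K) 0 (Matrix.specialUnitaryGroup (Fin 2) ℂ) |
                ∀ i', i' ≤ j → Averaging.iter (fun i'' => BlockAveraging.blockAvg (P := F.P K) (j := i'') ℰp) i' U ∈ C i'}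
              (1 : GaugeField (F.P K) 0 (Matrix.specialUnitaryGroup (Fin 2) ℂ) → ℝ) U *
             f (Averaging.iter (fun i'' => BlockAveraging.blockAvg (P := F.P K) (j := i'') ℰp) k U))
            ∂fieldMeasure (F.P K) 0 (Matrix.specialUnitaryGroup (Fin 2) ℂ) := by
  intro k hjk hk
  induction k with
  | zero =>
    obtain rfl : j = 0 := Nat.le_zero.mp hjk
    exact integral_pinnedTower_mul F K hγ C hC 0 σ hσ0 hσw hσf 0 le_rfl hk
  | succ k ih =>
    intro f hf hB
    rcases Nat.lt_or_eq_of_le hjk with hlt | heq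
    · have hjk' : j ≤ k := Nat.lt_succ_iff.mp hlt
      have hk' : k ≤ F.m + K := by omega
      obtain ⟨B, hB⟩ := hB
      have hint := integrable_pinnedTower F K hγ C hC j σ hσ0 hσw hσf k hk'
      have step := (rt F K k hk).isRT (σ k) hint f hf ⟨B, hB⟩
      rw [hσf k hk hjk', step]
      exact ih hjk' hk' (fun U => f ((BlockAveraging.blockAvg (P := F.P K) (j := k) ℰp).avg U))
        (hf.comp (measurable_blockAvg F K k)) ⟨B, fun U => hB _⟩
    · subst heq
      exact integral_pinnedTower_mul F K hγ C hC (k + 1) σ hσ0 hσw hσf (k + 1) le_rfl hk f hf hB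

/-! ## §2 The two towers agree almost everywhere -/

/-- ★★★ **A.E. BRIDGE**: at every level `j ≤ k ≤ m + K`, the level-by-level (7)-weighted tower `σ_k` EQUALS `dV_k`-a.e. the tree's restricted tower
`resDensity F γ K S k` of the history event `S = {U | ∀ i ≤ j, Ū^i U ∈ C i}` (restriction at level `0`, free transport): both are integrable and have
the same integral on every measurable set (§1 and lit `integral_resDensity_mul` with the test function `𝟙_s`).  Hence `∀ᵐ` bounds transfer between
the two currencies (★★OWNER RULING №32 (1): a.e. letters only). [cite: Balaban1985UV3, (2) p.256, (6)–(8) pp.257–258; Balaban1985Averaging, (10) p.19] -/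
theorem pinnedTower_ae_eq_resDensity (hγ : 0 ≤ γ) (C : (i : ℕ) → Set (GaugeField (F.P K) i (Matrix.specialUnitaryGroup (Fin 2) ℂ)))
    (hC : ∀ i, MeasurableSet (C i)) (j : ℕ) (σ : (k : ℕ) → Density (F.P K) k (Matrix.specialUnitaryGroup (Fin 2) ℂ))
    (hσ0 : σ 0 = (C 0).indicator (emlDensity F γ K 0))
    (hσw : ∀ (i : ℕ) (h : i + 1 ≤ F.m + K), i + 1 ≤ j → σ (i + 1) = (C (i + 1)).indicator ((rt F K i h).T (σ i)))
    (hσf : ∀ (i : ℕ) (h : i + 1 ≤ F.m + K), j ≤ i → σ (i + 1) = (rt F K i h).T (σ i))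
    {k : ℕ} (hjk : j ≤ k) (hk : k ≤ F.m + K) :
    σ k =ᵐ[fieldMeasure (F.P K) k (Matrix.specialUnitaryGroup (Fin 2) ℂ)]
      resDensity F γ K {U : GaugeField (F.P K) 0 (Matrix.specialUnitaryGroup (Fin 2) ℂ) |
        ∀ i, i ≤ j → Averaging.iter (fun i' => BlockAveraging.blockAvg (P := F.P K) (j := i') ℰp) i U ∈ C i} k := by
  set S := {U : GaugeField (F.P K) 0 (Matrix.specialUnitaryGroup (Fin 2) ℂ) |
      ∀ i, i ≤ j → Averaging.iter (fun i' => BlockAveraging.blockAvg (P := F.P K) (j := i') ℰp) i U ∈ C i} with hS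
  have hSm : MeasurableSet S := measurableSet_histEvent F K C hC j
  haveI := isProbabilityMeasure_fieldMeasure (G := Matrix.specialUnitaryGroup (Fin 2) ℂ) (F.P K) k
  have hσint := integrable_pinnedTower F K hγ C hC j σ hσ0 hσw hσf k hk
  have hρint := integrable_resDensity F K (S := S) hSm hγ hk
  refine Integrable.ae_eq_of_forall_setIntegral_eq _ _ hσint hρint fun s hs _ => ?_
  -- both set integrals are the same finest-lattice integral
  have hbd : ∃ B : ℝ, ∀ V : GaugeField (F.P K) k (Matrix.specialUnitaryGroup (Fin 2) ℂ),
      |s.indicator (1 : GaugeField (F.P K) k (Matrix.specialUnitaryGroup (Fin 2) ℂ) → ℝ) V| ≤ B := by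
    refine ⟨1, fun V => ?_⟩
    by_cases hV : V ∈ s
    · rw [Set.indicator_of_mem hV]; simp
    · rw [Set.indicator_of_notMem hV]; simp
  have h1 := integral_pinnedTower_mul_above F K hγ C hC j σ hσ0 hσw hσf k hjk hk (s.indicator 1) (measurable_one.indicator hs) hbd
  have h2 := integral_resDensity_mul F K (S := S) hSm hγ hk (s.indicator 1) (measurable_one.indicator hs) hbd
  rw [← integral_indicator hs, ← integral_indicator hs]
  have e1 : ∫ V, s.indicator (σ k) V ∂fieldMeasure (F.P K) k (Matrix.specialUnitaryGroup (Fin 2) ℂ) =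
      ∫ V, σ k V * s.indicator 1 V ∂fieldMeasure (F.P K) k (Matrix.specialUnitaryGroup (Fin 2) ℂ) := by
    refine integral_congr_ae (Filter.Eventually.of_forall fun V => ?_)
    by_cases hV : V ∈ s <;> simp [hV]
  have e2 : ∫ V, s.indicator (resDensity F γ K S k) V ∂fieldMeasure (F.P K) k (Matrix.specialUnitaryGroup (Fin 2) ℂ) =
      ∫ V, resDensity F γ K S k V * s.indicator 1 V ∂fieldMeasure (F.P K) k (Matrix.specialUnitaryGroup (Fin 2) ℂ) := by
    refine integral_congr_ae (Filter.Eventually.of_forall fun V => ?_)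
    by_cases hV : V ∈ s <;> simp [hV]
  rw [e1, e2, h1, h2]
  refine integral_congr_ae (Filter.Eventually.of_forall fun U => ?_)
  show emlDensity F γ K 0 U * (S.indicator 1 U * s.indicator 1 (Averaging.iter _ k U)) =
    S.indicator (boltzmann (F.P K) ((F.scheme ℰp γ).β K)) U * s.indicator 1 (Averaging.iter _ k U)
  rw [emlDensity_zero]
  by_cases hU : U ∈ S
  · rw [Set.indicator_of_mem hU, Set.indicator_of_mem hU]; simp
  · rw [Set.indicator_of_notMem hU, Set.indicator_of_notMem hU]; simp

/-! ## §3 The (Z-DOOR) in `resDensity` letters, any measurable event -/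

/-- ★★ **THE (Z-DOOR) IN `resDensity` LETTERS** (generic per-event letter; the `hP`-shaped consumer with the `essSup` anchor is LEAD's (A1″) door):
for a measurable event `S` of finest-lattice fields of the `K`-th approximation (`0 ≤ γ`), a level `k ≤ K`, reals `E Cu Cl w`, `0 ≤ w`:
(Z-UP) `∀ᵐ V ∂dV_k, resDensity F γ K S k V ≤ exp(−E + Cu)·w` ∧ (Z-LOW) `exp(−E − Cl) ≤ ∫ ρ_k dV_k` ⟹ `Gibbs_K(S) ≤ exp(Cu + Cl)·w`.
[cite: Balaban1985UV3, (2) p.256, (6) p.257, (41) p.266, (47) p.267] -/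
theorem gibbsK_real_le_of_resDensityBounds (hγ : 0 ≤ γ)
    {S : Set (GaugeField (F.P K) 0 (Matrix.specialUnitaryGroup (Fin 2) ℂ))} (hS : MeasurableSet S)
    {k : ℕ} (hkK : k ≤ K) {E Cu Cl w : ℝ} (hw : 0 ≤ w)
    (hUP : ∀ᵐ V ∂fieldMeasure (F.P K) k (Matrix.specialUnitaryGroup (Fin 2) ℂ), resDensity F γ K S k V ≤ Real.exp (-E + Cu) * w)
    (hLOW : Real.exp (-E - Cl) ≤ ∫ V, emlDensity F γ K k V ∂fieldMeasure (F.P K) k (Matrix.specialUnitaryGroup (Fin 2) ℂ)) :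
    (gibbsK F ℰp γ K).real S ≤ Real.exp (Cu + Cl) * w := by
  have hkm : k ≤ F.m + K := by omega
  haveI := isProbabilityMeasure_fieldMeasure (G := Matrix.specialUnitaryGroup (Fin 2) ℂ) (F.P K) k
  set Z : ℝ := partitionFn (G := Matrix.specialUnitaryGroup (Fin 2) ℂ) (F.P K) ((F.scheme ℰp γ).β K) with hZdef
  have hZpos : 0 < Z := partitionFn_pos' (G := Matrix.specialUnitaryGroup (Fin 2) ℂ) (F.P K) (F.scheme_β_nonneg ℰp hγ K)
  have hratio : (gibbsK F ℰp γ K).real S =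
      (∫ U, S.indicator 1 U * boltzmann (F.P K) ((F.scheme ℰp γ).β K) U
          ∂fieldMeasure (F.P K) 0 (Matrix.specialUnitaryGroup (Fin 2) ℂ)) / Z := by
    rw [← integral_indicator_one hS, gibbsK_eq, T4GenFunBounds.integral_gibbsMeasure _ (F.scheme_β_nonneg ℰp hγ K)]
  -- numerator = the restricted tower's mass at level k
  have hmass := integral_resDensity_mul F K (S := S) hS hγ hkm (fun _ => (1 : ℝ)) measurable_const ⟨1, fun _ => by simp⟩
  simp only [mul_one] at hmass
  have hnum : ∫ U, S.indicator 1 U * boltzmann (F.P K) ((F.scheme ℰp γ).β K) U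
      ∂fieldMeasure (F.P K) 0 (Matrix.specialUnitaryGroup (Fin 2) ℂ) ≤ Real.exp (-E + Cu) * w := by
    have hcomm : ∫ U, S.indicator 1 U * boltzmann (F.P K) ((F.scheme ℰp γ).β K) U
        ∂fieldMeasure (F.P K) 0 (Matrix.specialUnitaryGroup (Fin 2) ℂ) =
        ∫ V, resDensity F γ K S k V ∂fieldMeasure (F.P K) k (Matrix.specialUnitaryGroup (Fin 2) ℂ) := by
      rw [hmass]
      refine integral_congr_ae (Filter.Eventually.of_forall fun U => ?_)
      show S.indicator 1 U * boltzmann (F.P K) ((F.scheme ℰp γ).β K) U = S.indicator (boltzmann (F.P K) ((F.scheme ℰp γ).β K)) U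
      by_cases hU : U ∈ S
      · rw [Set.indicator_of_mem hU, Set.indicator_of_mem hU]; simp
      · rw [Set.indicator_of_notMem hU, Set.indicator_of_notMem hU]; simp
    rw [hcomm]
    calc ∫ V, resDensity F γ K S k V ∂fieldMeasure (F.P K) k (Matrix.specialUnitaryGroup (Fin 2) ℂ)
        ≤ ∫ _V, Real.exp (-E + Cu) * w ∂fieldMeasure (F.P K) k (Matrix.specialUnitaryGroup (Fin 2) ℂ) :=
          integral_mono_ae (integrable_resDensity F K (S := S) hS hγ hkm) (integrable_const _) hUP
      _ = Real.exp (-E + Cu) * w := by rw [integral_const, smul_eq_mul, probReal_univ, one_mul]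
  have hden : Real.exp (-E - Cl) ≤ Z := by
    rw [hZdef, ← integral_emlDensity_eq_partitionFn F K hγ k hkm]
    exact hLOW
  rw [hratio, div_le_iff₀ hZpos]
  have h1 : Real.exp (-E + Cu) * w = Real.exp (Cu + Cl) * w * Real.exp (-E - Cl) := by
    rw [mul_assoc, mul_comm w, ← mul_assoc, ← Real.exp_add]
    congr 1
    congr 1
    ring
  have h2 : Real.exp (Cu + Cl) * w * Real.exp (-E - Cl) ≤ Real.exp (Cu + Cl) * w * Z :=
    mul_le_mul_of_nonneg_left hden (mul_nonneg (Real.exp_pos _).le hw)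
  linarith [hnum, h1, h2]

end Summit.QuantumFields.YangMills.Theorems.UV3PinnedTowerAeBridge

end
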